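import Summits.HubbardSuperconductivity.HubbardSuperconductivity.Theorems.InfiniteVolumeFirstNoNormalLimitStateStubCofinalLroTransfer
import Summits.HubbardSuperconductivity.HubbardSuperconductivity.Theorems.ChiralWindowCwThesisPenaltyResponseLRO
import HarnessLib

/-!
# Crux `NoNormalLimitState` (stmt-HubbardSuperconductivity-18533, route `InfiniteVolumeFirst`) —
# reductions: the crux sits BELOW route `TorusCooperLog`'s cruxes and below its own line's stub

Sorry-free entry points through which the infinite-volume-first crux r2 `NoNormalLimitState`
(`∃ δ ∀ U₀ ∃ U ∈ (0,U₀)`: every torus-limit ground state has a `d_{x²-y²}` condensate atom) is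
IMPLIED by statements already on the ledger, locating its open content (companion of
`InfiniteVolumeFirstNoNormalLimitStateWcbcsBridge`-type edges through route `WeakCouplingBCS`'s
target `WcbcsThesis`, stmt-2007, which are NOT repeated here):

* `stub_torusCooperLogTransfer` — route `TorusCooperLog`'s cruxes `CertB1g`
  (stmt-HubbardSuperconductivity-2682: certified Kohn–Luttinger `B₁g` datum at one doping) and
  `KLCanonical` (stmt-HubbardSuperconductivity-2681: datum ⇒ eventual intensive pair-penalty response
  for ALL small `U`) give, through the landed support `PenaltyResponseLRO`
  (`CwThesis.stub_penaltyResponseLRO`), every-ground-state pair LRO at the certified doping for all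
  `U ∈ (0,U₀)`; "all small `U`" is cofinal at `0⁺`, so the landed transfer `stub_cofinalLroTransfer`
  (even-side LRO ⇒ window floors ⇒ atom of every pointwise limit, no tightness) gives the crux;
* `noNormalLimitState_of_windowGapCofinal` — the composition of the registered line
  `window-gap-transfer` (`Cruxes/NoNormalLimitState/Lines/window_gap_transfer.lean`), sorry-free as an
  implication: its one open stub `stub_windowGapCofinal` (ε-uniform Kac-window gap of the penalised
  sector ground-state energy density at cofinally weak coupling) implies the crux, via the chord
  inequality (`chord_div_le_re_expect_of_eigen`), the window identity `re_expect_windowPenalty` and the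
  landed `stub_windowFloorAtom`.

So `NoNormalLimitState` is weaker than `CertB1g ∧ KLCanonical` and than `stub_windowGapCofinal`, both
of which contain the same missing engine (a `T = 0` weak-coupling construction of the 2-d Hubbard
ground state across the Kohn–Luttinger scale). Pure logic over landed lemmas; no definition and no
named fact is introduced. Sources: Scalapino, Phys. Rep. 250 (1995) 329, §2 eq. (2.4); Tasaki (2020)
§2.1; Kennedy–Lieb–Shastry, PRL 61 (1988) 2582.
-/

noncomputable section

-- the mandated namespace `Summit.<Summit>.<Problem>.Theorems` repeats `HubbardSuperconductivity`
-- (single-problem summit, D-0017), which the `dupNamespace` linter flags on every declaration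
set_option linter.dupNamespace false

namespace Summit.HubbardSuperconductivity.HubbardSuperconductivity.Theorems.NoNormalLimitState

open Literature.MathematicalPhysics.QuantumLattice Literature.Probability.LatticeModels Matrix Finset
  Filter
open Summit.HubbardSuperconductivity.HubbardSuperconductivity.Theses
open scoped ComplexConjugate ComplexOrder Topology

/-! ### Route `TorusCooperLog`: its two cruxes imply the crux -/

/-- **The two cruxes of route `TorusCooperLog` imply `NoNormalLimitState`**: the certified
Kohn–Luttinger `B₁g` datum `CertB1g` (stmt-HubbardSuperconductivity-2682) fixes a doping
`δ ∈ (0,1/2)`; `KLCanonical` (stmt-HubbardSuperconductivity-2681) turns the datum into an eventual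
intensive pair-penalty response `c·κ ≤ E_L(U;κ) - E_L(U;0)` for EVERY `U ∈ (0,U₀)`; the landed support
`PenaltyResponseLRO` (`CwThesis.stub_penaltyResponseLRO`, chord inequality) makes it
every-ground-state LRO at `(U, δ)`; given `U₁ > 0` the coupling `min(U₀,U₁)/2` lies in both windows, and
the landed cofinal transfer `stub_cofinalLroTransfer` concludes. Scalapino, Phys. Rep. 250 (1995) §2
eq. (2.4); Tasaki (2020) §2.1; Kennedy–Lieb–Shastry, PRL 61 (1988) 2582. [folklore] -/
theorem stub_torusCooperLogTransfer :
    Summit.HubbardSuperconductivity.HubbardSuperconductivity.Theses.TorusCooperLog.CertB1g →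
      Summit.HubbardSuperconductivity.HubbardSuperconductivity.Theses.TorusCooperLog.KLCanonical →
        Summit.HubbardSuperconductivity.HubbardSuperconductivity.Theses.InfiniteVolumeFirst.NoNormalLimitState := by
  rintro ⟨δ, hδ, hdat⟩ hKL
  obtain ⟨U₀, hU₀, hresp⟩ := hKL δ hδ hdat
  refine stub_cofinalLroTransfer ⟨δ, hδ, fun U₁ hU₁ => ?_⟩
  have hpos : (0 : ℝ) < min U₀ U₁ / 2 := half_pos (lt_min hU₀ hU₁)
  have hlt : min U₀ U₁ / 2 < min U₀ U₁ := half_lt_self (lt_min hU₀ hU₁)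
  refine ⟨min U₀ U₁ / 2, ⟨hpos, lt_of_lt_of_le hlt (min_le_right U₀ U₁)⟩, fun N ψ hadm => ?_⟩
  obtain ⟨κ, hκ, c, hc, hev⟩ := hresp (min U₀ U₁ / 2) ⟨hpos, lt_of_lt_of_le hlt (min_le_left U₀ U₁)⟩
  exact CwThesis.stub_penaltyResponseLRO (min U₀ U₁ / 2) δ κ c hκ hc hev N ψ hadm

/-! ### Line `window-gap-transfer`: the registered stub `stub_windowGapCofinal` implies the crux -/

/-- **The Kac-window penalty in a state**: `Re⟨ψ, W_ε ψ⟩ = Σ_{|q_m| ≤ ε} S_ψ(m)` for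
`W_ε = Σ_{|q_m| ≤ ε} L⁻² Δ_d(m)ᴴ Δ_d(m)` (the identity `KacWindowPenalty.re_expect_window` of
`Theorems/KacWindowPenaltyTargetImpliesSummit.lean`, re-derived to keep this file's import closure
inside routes `InfiniteVolumeFirst` / `WeakCouplingBCS` / `TorusCooperLog`). [folklore] -/
theorem re_expect_windowPenalty (L : ℕ) [NeZero L] (ε : ℝ) (ψ : Fock (Orb (FermionTorus 2 L))) :
    (star ψ ⬝ᵥ (∑ m : TorusSite 2 L, if momentumNormSq L m ≤ ε ^ 2 then
        ((L : ℂ) ^ 2)⁻¹ • ((pairFieldAt dWaveFormFactor L m)ᴴ * pairFieldAt dWaveFormFactor L m)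
        else 0) *ᵥ ψ).re =
      ∑ m : TorusSite 2 L, if momentumNormSq L m ≤ ε ^ 2 then
        pairStructureFactor dWaveFormFactor L ψ m else 0 := by
  rw [sum_mulVec, dotProduct_sum, Complex.re_sum]
  refine Finset.sum_congr rfl fun m _ => ?_
  split_ifs with hm
  · rw [smul_mulVec, dotProduct_smul, smul_eq_mul, ← Literature.MathematicalPhysics.QuantumLattice.star_mulVec_dotProduct_mulVec,
      pairStructureFactor_apply,
      show ((L : ℂ) ^ 2)⁻¹ = ((((L : ℝ) ^ 2)⁻¹ : ℝ) : ℂ) by push_cast; rfl, Complex.re_ofReal_mul,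
      div_eq_inv_mul]
  · rw [zero_mulVec, dotProduct_zero, Complex.zero_re]

/-- **Every ground state keeps the window floor** (one side `L`; the sandwich step of route
`KacWindowPenalty` transferred): if `λ a L² ≤ minEnergyOn (H_L + λ W_ε) K − minEnergyOn H_L K` with
`λ > 0` and `ψ` is a normalised ground state of `H_L = hubbardTorus 2 L 1 U` in `K = szSector N 0`, then
`a L² ≤ Σ_{|q_m| ≤ ε} S_ψ(m)` — chord inequality `chord_div_le_re_expect_of_eigen` and
`re_expect_windowPenalty`. Wang et al., arXiv:2310.05844, §II; Tasaki (2020) §2.1. [folklore] -/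
theorem windowFloor_of_windowGap (L : ℕ) [NeZero L] (U : ℝ) {ε lam a : ℝ} (hlam : 0 < lam) (N : ℕ)
    {ψ : Fock (Orb (FermionTorus 2 L))} (hψ1 : star ψ ⬝ᵥ ψ = 1)
    (hψ : IsGroundStateInSector (hubbardTorus 2 L 1 U) N 0 ψ)
    (hgap : lam * a * (L : ℝ) ^ 2 ≤
      (hubbardTorus 2 L 1 U + (lam : ℂ) • ∑ m : TorusSite 2 L, if momentumNormSq L m ≤ ε ^ 2 then
        ((L : ℂ) ^ 2)⁻¹ • ((pairFieldAt dWaveFormFactor L m)ᴴ * pairFieldAt dWaveFormFactor L m)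
        else 0).minEnergyOn (szSector N 0) - (hubbardTorus 2 L 1 U).minEnergyOn (szSector N 0)) :
    a * (L : ℝ) ^ 2 ≤ ∑ m : TorusSite 2 L,
      if momentumNormSq L m ≤ ε ^ 2 then pairStructureFactor dWaveFormFactor L ψ m else 0 := by
  obtain ⟨hmem, -, heig⟩ := hψ
  have hch := chord_div_le_re_expect_of_eigen (hubbardTorus 2 L 1 U)
    (∑ m : TorusSite 2 L, if momentumNormSq L m ≤ ε ^ 2 then
        ((L : ℂ) ^ 2)⁻¹ • ((pairFieldAt dWaveFormFactor L m)ᴴ * pairFieldAt dWaveFormFactor L m)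
        else 0) (szSector N 0) hlam hmem hψ1 heig
  rw [re_expect_windowPenalty, div_le_iff₀ hlam] at hch
  have h : lam * (a * (L : ℝ) ^ 2) ≤ lam * ∑ m : TorusSite 2 L,
      if momentumNormSq L m ≤ ε ^ 2 then pairStructureFactor dWaveFormFactor L ψ m else 0 := by
    rw [← mul_assoc]
    linarith
  exact le_of_mul_le_mul_left h hlam

/-- **The line `window-gap-transfer` as an implication: `stub_windowGapCofinal` ⇒ the crux.**
If at some `δ ∈ (0,1/2)`, for every `U₀ > 0`, some `U ∈ (0,U₀)` and some `a > 0` have, for every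
window radius `ε > 0`, a penalty strength `λ > 0` and a threshold beyond which
`minEnergyOn (H_L + λ W_ε) K_L − minEnergyOn H_L K_L ≥ λ a L²` at all even `L`
(`K_L = szSector N_L 0`, `N_L = 2⌊(1−δ)L²/2⌋`; the registered stub of the line, verbatim), then
`NoNormalLimitState`: the sandwich `windowFloor_of_windowGap` gives every admissible ground state the
window floor `a L²` at every scale, and the landed `stub_windowFloorAtom` (lower Fejér bound) turns
floors at every scale into the atom `≥ a > 0` of every pointwise limit. This is the composition
`NoNormalLimitState_of` of `Cruxes/NoNormalLimitState/Lines/window_gap_transfer.lean`, sorry-free.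
Wang et al., arXiv:2310.05844, §II; Kennedy–Lieb–Shastry, PRL 61 (1988) 2582. [folklore] -/
theorem noNormalLimitState_of_windowGapCofinal
    (h : ∃ δ ∈ Set.Ioo (0:ℝ) (1 / 2), ∀ U₀ : ℝ, 0 < U₀ → ∃ U ∈ Set.Ioo (0:ℝ) U₀, ∃ a : ℝ, 0 < a ∧
      ∀ ε : ℝ, 0 < ε → ∃ lam : ℝ, 0 < lam ∧ ∃ L₀ : ℕ, ∀ (L : ℕ) [NeZero L], Even L → L₀ ≤ L →
        lam * a * (L : ℝ) ^ 2 ≤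
          (hubbardTorus 2 L 1 U + (lam : ℂ) • ∑ m : TorusSite 2 L,
              if momentumNormSq L m ≤ ε ^ 2 then
                ((L : ℂ) ^ 2)⁻¹ •
                  ((pairFieldAt dWaveFormFactor L m)ᴴ * pairFieldAt dWaveFormFactor L m)
              else 0).minEnergyOn (szSector (2 * ⌊(1 - δ) * (L : ℝ) ^ 2 / 2⌋₊) 0) -
            (hubbardTorus 2 L 1 U).minEnergyOn (szSector (2 * ⌊(1 - δ) * (L : ℝ) ^ 2 / 2⌋₊) 0)) :
    InfiniteVolumeFirst.NoNormalLimitState := by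
  obtain ⟨δ, hδ, hU⟩ := h
  refine ⟨δ, hδ, fun U₀ hU₀ => ?_⟩
  obtain ⟨U, hUmem, a, ha, hgap⟩ := hU U₀ hU₀
  refine ⟨U, hUmem, fun N ψ hadm Ls C hLs hev hconv => ?_⟩
  have hnorm : ∀ L, Even L → star (ψ L) ⬝ᵥ ψ L = 1 := fun L hL => (hadm L hL).2.1
  have hfloor : ∀ ε : ℝ, 0 < ε → ∃ L₀ : ℕ, ∀ (L : ℕ) [NeZero L], Even L → L₀ ≤ L →
      a * (L : ℝ) ^ 2 ≤ ∑ m : TorusSite 2 L, if momentumNormSq L m ≤ ε ^ 2 then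
        pairStructureFactor dWaveFormFactor L (ψ L) m else 0 := by
    intro ε hε
    obtain ⟨lam, hlam, L₀, hL₀⟩ := hgap ε hε
    refine ⟨L₀, fun L _ hLe hLge => ?_⟩
    obtain ⟨hN, hψ1, hgs⟩ := hadm L hLe
    rw [hN] at hgs
    exact windowFloor_of_windowGap L U hlam _ hψ1 hgs (hL₀ L hLe hLge)
  exact lt_of_lt_of_le ha (stub_windowFloorAtom ψ a ha hnorm hfloor Ls C hLs hev hconv)

end Summit.HubbardSuperconductivity.HubbardSuperconductivity.Theorems.NoNormalLimitState

end
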